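import Mathlib.Analysis.Calculus.FDeriv.Analytic
import Mathlib.Analysis.Calculus.ContDiff.Basic
import Mathlib.Data.Nat.Factorial.Basic
import Literature.Analysis.PDE.CoordWordDeriv
import HarnessLib

/-!
# Word derivatives of composite maps: the Faà di Bruno bookkeeping (topic `Analysis/PDE`)

Analysis/PDE support file. The `H^m` energy method for quasilinear symmetric hyperbolic systems
(Majda 1984, Ch. 2 §2.1, proof of Thm 2.1: the commutators `∂^α(A(u)∂ⱼv) - A(u)∂^α∂ⱼv`; Dafermos
2005, (5.1.11)–(5.1.12); Taylor, *PDE III*, Ch. 13 §3, Moser estimates) needs the STRUCTURE of a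
coordinate word derivative of a composite coefficient `A ∘ V` (`A` a smooth map of the unknowns,
`V` the field): it is a finite sum of terms

  `(D^k A)(V(y)) [∂_{b₁} V(y), …, ∂_{b_k} V(y)]`

with nonempty words `b₁, …, b_k` whose lengths add up to the length of the word (Faà di Bruno),
so that each term can be bounded by `‖D^k A‖ ∏ₗ ‖∂_{bₗ} V‖` and then split "largest factor in
`L²`, the others in `L^∞`". This file provides exactly that bookkeeping for the coordinate word
derivatives `cwd` of `CoordWordDeriv.lean` on `ℝ^ι = EuclideanSpace ℝ ι`:

* `FdbTerm ι = Σ k, Fin k → List ι` — a number of blocks and the blocks; `fdbEval A V T y` — its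
  evaluation `(D^{T.1} A)(V y) (fun l ↦ ∂_{T.2 l} V y)` (Mathlib `iteratedFDeriv`);
* `fdbChildren i T` — the `1 + k` terms of `∂ᵢ (fdbEval A V T)` (`fderiv_fdbEval_apply`: the chain
  rule adds the block `[i]` in front, the Leibniz rule prolongs one block by `i`; Mathlib
  `HasFDerivAt.continuousMultilinearMap_apply`, `iteratedFDeriv_succ_apply_left`);
* `fdbTerms a` — all terms of `∂_a (A ∘ V)` and **`cwd_comp_eq_sum_fdbEval`**:
  `∂_a (A ∘ V) (y) = Σ_{T ∈ fdbTerms a} fdbEval A V T y`;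
* the invariants of the terms of `fdbTerms a`: the block lengths add up to `|a|`
  (`sum_length_eq_of_mem_fdbTerms`), every block is nonempty (`ne_nil_of_mem_fdbTerms`), there
  are between `1` (for `a ≠ []`) and `|a|` blocks (`one_le_fst_of_mem_fdbTerms`,
  `fst_le_length_of_mem_fdbTerms`), and there are at most `|a|!` terms
  (`length_fdbTerms_le_factorial`);
* `norm_fdbEval_le` — `‖fdbEval A V T y‖ ≤ ‖D^{T.1}A (V y)‖ ∏ₗ ‖∂_{T.2 l} V (y)‖`.

Everything is proved; no named fact and no `sorry` is introduced. Sobolev / `L²`–`L^∞` bounds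
are NOT here (they live with the torus energies).

## Mathlib / tree search

Mathlib has the pointwise Faà di Bruno BOUND `norm_iteratedFDeriv_comp_le`
(`‖D^n(g ∘ f)‖ ≤ n! C D^n`), which forgets the partition structure needed for the `L²`–`L^∞`
splitting, and `FormalMultilinearSeries.taylorComp` / `HasFTaylorSeriesUpToOn.comp` (the Faà di
Bruno FORMULA for full Fréchet derivatives via `OrderedFinpartition`), whose combinatorics is
heavier than the coordinate-word recursion used here. Tree: `cwd`, `cwd_cons`, `cwd_singleton`,
`differentiable_cwd`, `fderiv_list_sum_map_apply` (`CoordWordDeriv`); the scalar two-field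
version of the same bookkeeping on the torus is `Torus.DiffMonomial`
(`FunctionSpaces/TorusDiffMonomials`, coefficients `g(φ_a, φ_b)`).

## References

* A. Majda, *Compressible Fluid Flow and Systems of Conservation Laws in Several Space
  Variables*, Springer 1984, Ch. 2 §2.1, Prop. 2.1 and proof of Thm 2.1. [`Majda1984`]
* M. E. Taylor, *Partial Differential Equations III*, 2nd ed., Springer 2011, Ch. 13 §3
  (3.19)–(3.22) (Moser estimates for `F(u)`). [`TaylorPDEIII2011`]
* C. M. Dafermos, *Hyperbolic Conservation Laws in Continuum Physics*, 2nd ed., 2005, §5.1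
  (5.1.11)–(5.1.12). [`Dafermos2005`]
-/

noncomputable section

open Set Function
open scoped ContDiff

namespace Literature.Analysis.PDE

variable {ι : Type*} [Fintype ι]
variable {W' X : Type*} [NormedAddCommGroup W'] [NormedSpace ℝ W'] [NormedAddCommGroup X]
  [NormedSpace ℝ X]

/-! ## Terms, evaluation, children -/

/-- **A Faà di Bruno term**: a number of blocks `k` and the blocks `b₀, …, b_{k-1}`, coordinate
words. It stands for `(D^k A)(V) [∂_{b₀}V, …, ∂_{b_{k-1}}V]`. [folklore] -/
abbrev FdbTerm (ι : Type*) : Type _ := Σ k : ℕ, Fin k → List ι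

/-- **Evaluation of a Faà di Bruno term** on a coefficient map `A : W' → X` and a field
`V : ℝ^ι → W'`: `fdbEval A V ⟨k, b⟩ y = (D^k A)(V y) (fun l ↦ ∂_{b l} V y)`
(Mathlib `iteratedFDeriv`, tree `cwd`). [folklore] -/
def fdbEval (A : W' → X) (V : EuclideanSpace ℝ ι → W') (T : FdbTerm ι) (y : EuclideanSpace ℝ ι) :
    X :=
  iteratedFDeriv ℝ T.1 A (V y) fun l => cwd (T.2 l) V y

/-- Unfolding of `fdbEval`. [folklore] -/
theorem fdbEval_apply (A : W' → X) (V : EuclideanSpace ℝ ι → W') (T : FdbTerm ι)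
    (y : EuclideanSpace ℝ ι) :
    fdbEval A V T y = iteratedFDeriv ℝ T.1 A (V y) fun l => cwd (T.2 l) V y := rfl

/-- The term with no block evaluates to `A (V y)`. [folklore] -/
theorem fdbEval_zero (A : W' → X) (V : EuclideanSpace ℝ ι → W') (b : Fin 0 → List ι)
    (y : EuclideanSpace ℝ ι) : fdbEval A V ⟨0, b⟩ y = A (V y) := by
  simp [fdbEval]

/-- **The `∂ᵢ`-children of a term** `⟨k, b⟩`: the chain-rule child `⟨k + 1, [i] :: b⟩` and the
`k` Leibniz children `⟨k, b with bₗ replaced by i :: bₗ⟩`. [folklore] -/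
def fdbChildren (i : ι) (T : FdbTerm ι) : List (FdbTerm ι) :=
  ⟨T.1 + 1, Fin.cons [i] T.2⟩ :: List.ofFn fun l : Fin T.1 => ⟨T.1, update T.2 l (i :: T.2 l)⟩

/-- **All Faà di Bruno terms of the word derivative `∂_a (A ∘ V)`**, by recursion on the word
(outermost letter first, as `cwd`). [folklore] -/
def fdbTerms : List ι → List (FdbTerm ι)
  | [] => [⟨0, Fin.elim0⟩]
  | i :: a => (fdbTerms a).flatMap (fdbChildren i)

omit [Fintype ι] in
/-- `fdbTerms [] = [⟨0, _⟩]`. [folklore] -/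
@[simp] theorem fdbTerms_nil : fdbTerms ([] : List ι) = [⟨0, Fin.elim0⟩] := rfl

omit [Fintype ι] in
/-- `fdbTerms (i :: a) = (fdbTerms a).flatMap (fdbChildren i)`. [folklore] -/
@[simp] theorem fdbTerms_cons (i : ι) (a : List ι) :
    fdbTerms (i :: a) = (fdbTerms a).flatMap (fdbChildren i) := rfl

/-! ## The derivative of a term -/

/-- Sums over `flatMap`ped lists: `Σ_{x ∈ l.flatMap f} g x = Σ_{a ∈ l} Σ_{x ∈ f a} g x`
(a private copy of `sum_map_flatMap` of `Transfer.lean`, to keep the import closure small).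
[folklore] -/
private theorem fdb_sum_map_flatMap {α β M : Type*} [AddMonoid M] (l : List α) (f : α → List β) (g : β → M) :
    ((l.flatMap f).map g).sum = (l.map fun a => ((f a).map g).sum).sum := by
  induction l with
  | nil => simp
  | cons a l ih => simp [List.flatMap_cons, List.sum_append, ih]

/-- **The derivative of a Faà di Bruno term along `eᵢ` is the sum of its `∂ᵢ`-children**
(chain rule on `D^k A ∘ V`, Leibniz rule on the multilinear evaluation; Mathlib
`HasFDerivAt.continuousMultilinearMap_apply`). [folklore] -/
theorem hasFDerivAt_fdbEval {A : W' → X} {V : EuclideanSpace ℝ ι → W'} (hA : ContDiff ℝ ∞ A)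
    (hV : ContDiff ℝ ∞ V) (T : FdbTerm ι) (y : EuclideanSpace ℝ ι) :
    ∃ L : EuclideanSpace ℝ ι →L[ℝ] X, HasFDerivAt (fdbEval A V T) L y ∧
      ∀ i, L (bv i) = ((fdbChildren i T).map fun T' => fdbEval A V T' y).sum := by
  obtain ⟨k, b⟩ := T
  -- the outer map `y ↦ D^k A (V y)` and the inner maps `y ↦ ∂_{b l} V y`
  have hAk : Differentiable ℝ (iteratedFDeriv ℝ k A) :=
    hA.differentiable_iteratedFDeriv (mod_cast ENat.coe_lt_top k)
  have hVd : Differentiable ℝ V := hV.differentiable (by simp)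
  have hf : HasFDerivAt (fun y => iteratedFDeriv ℝ k A (V y))
      ((fderiv ℝ (iteratedFDeriv ℝ k A) (V y)).comp (fderiv ℝ V y)) y :=
    (hAk (V y)).hasFDerivAt.comp y (hVd y).hasFDerivAt
  have hg : ∀ l : Fin k, HasFDerivAt (cwd (b l) V) (fderiv ℝ (cwd (b l) V) y) y := fun l =>
    (differentiable_cwd hV (b l) y).hasFDerivAt
  have h := hf.continuousMultilinearMap_apply hg
  refine ⟨_, h, fun i => ?_⟩
  simp only [fdbChildren, List.map_cons, List.sum_cons, List.map_ofFn, List.sum_ofFn]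
  rw [add_apply, sum_apply]
  -- the chain-rule child is definitionally the first summand (`iteratedFDeriv_succ_apply_left`,
  -- `cwd_singleton` are `rfl`); the Leibniz children:
  congr 1
  refine Finset.sum_congr rfl fun l _ => ?_
  rw [ContinuousLinearMap.comp_apply, ContinuousMultilinearMap.toContinuousLinearMap_apply,
    Function.comp_apply, fdbEval_apply]
  show iteratedFDeriv ℝ k A (V y) (update (fun l => cwd (b l) V y) l (fderiv ℝ (cwd (b l) V) y (bv i))) =
    iteratedFDeriv ℝ k A (V y) fun l' => cwd (update b l (i :: b l) l') V y
  congr 1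
  funext l'
  by_cases hl : l' = l
  · subst hl
    simp only [update_self, cwd_cons]
  · simp only [update_of_ne hl]

/-- Faà di Bruno terms are differentiable in `y`. [folklore] -/
theorem differentiable_fdbEval {A : W' → X} {V : EuclideanSpace ℝ ι → W'} (hA : ContDiff ℝ ∞ A)
    (hV : ContDiff ℝ ∞ V) (T : FdbTerm ι) : Differentiable ℝ (fdbEval A V T) := fun y =>
  (hasFDerivAt_fdbEval hA hV T y).choose_spec.1.differentiableAt

/-- **`∂ᵢ` of a Faà di Bruno term** is the sum of its children. [folklore] -/
theorem fderiv_fdbEval_apply {A : W' → X} {V : EuclideanSpace ℝ ι → W'} (hA : ContDiff ℝ ∞ A)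
    (hV : ContDiff ℝ ∞ V) (T : FdbTerm ι) (y : EuclideanSpace ℝ ι) (i : ι) :
    fderiv ℝ (fdbEval A V T) y (bv i) = ((fdbChildren i T).map fun T' => fdbEval A V T' y).sum := by
  obtain ⟨L, hL, hLi⟩ := hasFDerivAt_fdbEval hA hV T y
  rw [hL.fderiv, hLi i]

/-! ## The Faà di Bruno expansion of a word derivative -/

/-- **Faà di Bruno for coordinate words**: for smooth `A : W' → X` and `V : ℝ^ι → W'`,
`∂_a (A ∘ V)(y) = Σ_{T ∈ fdbTerms a} (D^{T.1}A)(V y) [∂_{T.2 0}V(y), …]`.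
[cite: TaylorPDEIII2011, Ch. 13 §3 (3.19)–(3.22)] -/
theorem cwd_comp_eq_sum_fdbEval {A : W' → X} {V : EuclideanSpace ℝ ι → W'} (hA : ContDiff ℝ ∞ A)
    (hV : ContDiff ℝ ∞ V) :
    ∀ (a : List ι) (y : EuclideanSpace ℝ ι),
      cwd a (A ∘ V) y = ((fdbTerms a).map fun T => fdbEval A V T y).sum
  | [], y => by simp [fdbEval_zero]
  | i :: a, y => by
    have ih : cwd a (A ∘ V) = fun y => ((fdbTerms a).map fun T => fdbEval A V T y).sum :=
      funext fun y => cwd_comp_eq_sum_fdbEval hA hV a y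
    rw [cwd_cons]
    show fderiv ℝ (cwd a (A ∘ V)) y (bv i) = _
    rw [ih, fderiv_list_sum_map_apply (fdbTerms a) (fun T _ => differentiable_fdbEval hA hV T) y (bv i),
      fdbTerms_cons, fdb_sum_map_flatMap]
    congr 1
    exact List.map_congr_left fun T _ => fderiv_fdbEval_apply hA hV T y i

/-! ## Invariants of the terms -/

omit [Fintype ι] in
/-- Membership in the children of a term. [folklore] -/
theorem mem_fdbChildren_iff {i : ι} {T T' : FdbTerm ι} :
    T' ∈ fdbChildren i T ↔ T' = ⟨T.1 + 1, Fin.cons [i] T.2⟩ ∨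
      ∃ l : Fin T.1, T' = ⟨T.1, update T.2 l (i :: T.2 l)⟩ := by
  simp only [fdbChildren, List.mem_cons, List.mem_ofFn, eq_comm]

omit [Fintype ι] in
/-- **The block lengths of a term of `∂_a(A ∘ V)` add up to `|a|`.** [folklore] -/
theorem sum_length_eq_of_mem_fdbTerms :
    ∀ {a : List ι} {T : FdbTerm ι}, T ∈ fdbTerms a → ∑ l, (T.2 l).length = a.length
  | [], T, hT => by
    simp only [fdbTerms_nil, List.mem_singleton] at hT
    subst hT
    simp
  | i :: a, T, hT => by
    simp only [fdbTerms_cons, List.mem_flatMap] at hT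
    obtain ⟨T₀, hT₀, hT⟩ := hT
    have ih := sum_length_eq_of_mem_fdbTerms hT₀
    rcases mem_fdbChildren_iff.1 hT with rfl | ⟨l, rfl⟩
    · rw [Fin.sum_univ_succ]
      simp only [Fin.cons_zero, Fin.cons_succ, List.length_cons, List.length_nil, ih]
      omega
    · simp only [List.length_cons]
      rw [← ih, ← Finset.sum_erase_add _ _ (Finset.mem_univ l),
        ← Finset.sum_erase_add _ _ (Finset.mem_univ l)]
      simp only [update_self, List.length_cons]
      rw [Finset.sum_congr rfl fun l' hl' => by
        rw [update_of_ne (Finset.ne_of_mem_erase hl')]]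
      omega

omit [Fintype ι] in
/-- **Every block of a term of `∂_a(A ∘ V)` is a nonempty word.** [folklore] -/
theorem ne_nil_of_mem_fdbTerms :
    ∀ {a : List ι} {T : FdbTerm ι}, T ∈ fdbTerms a → ∀ l, T.2 l ≠ []
  | [], T, hT => by
    simp only [fdbTerms_nil, List.mem_singleton] at hT
    subst hT
    exact fun l => l.elim0
  | i :: a, T, hT => by
    simp only [fdbTerms_cons, List.mem_flatMap] at hT
    obtain ⟨T₀, hT₀, hT⟩ := hT
    have ih := ne_nil_of_mem_fdbTerms hT₀
    rcases mem_fdbChildren_iff.1 hT with rfl | ⟨l₀, rfl⟩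
    · intro l
      refine Fin.cases ?_ (fun l' => ?_) l
      · simp
      · simpa using ih l'
    · intro l
      by_cases hl : l = l₀
      · rw [hl]; simp
      · show update T₀.2 l₀ (i :: T₀.2 l₀) l ≠ []
        rw [update_of_ne hl]
        exact ih l

omit [Fintype ι] in
/-- The number of blocks of a term of `∂_a(A ∘ V)` is at most `|a|`. [folklore] -/
theorem fst_le_length_of_mem_fdbTerms :
    ∀ {a : List ι} {T : FdbTerm ι}, T ∈ fdbTerms a → T.1 ≤ a.length
  | [], T, hT => by
    simp only [fdbTerms_nil, List.mem_singleton] at hT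
    subst hT
    simp
  | i :: a, T, hT => by
    simp only [fdbTerms_cons, List.mem_flatMap] at hT
    obtain ⟨T₀, hT₀, hT⟩ := hT
    have ih := fst_le_length_of_mem_fdbTerms hT₀
    rcases mem_fdbChildren_iff.1 hT with rfl | ⟨l, rfl⟩
    · simpa using ih
    · simp only [List.length_cons]; omega

omit [Fintype ι] in
/-- A term of `∂_a(A ∘ V)` with `a ≠ []` has at least one block. [folklore] -/
theorem one_le_fst_of_mem_fdbTerms {a : List ι} (ha : a ≠ []) {T : FdbTerm ι}
    (hT : T ∈ fdbTerms a) : 1 ≤ T.1 := by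
  obtain ⟨i, a, rfl⟩ := List.exists_cons_of_ne_nil ha
  simp only [fdbTerms_cons, List.mem_flatMap] at hT
  obtain ⟨T₀, _, hT⟩ := hT
  rcases mem_fdbChildren_iff.1 hT with rfl | ⟨l, rfl⟩
  · simp
  · exact Nat.one_le_iff_ne_zero.2 fun h => (Fin.cast h l).elim0

omit [Fintype ι] in
/-- Each block of a term of `∂_a(A ∘ V)` has length at most `|a|`. [folklore] -/
theorem length_le_of_mem_fdbTerms {a : List ι} {T : FdbTerm ι} (hT : T ∈ fdbTerms a) (l : Fin T.1) :
    (T.2 l).length ≤ a.length := by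
  rw [← sum_length_eq_of_mem_fdbTerms hT]
  exact Finset.single_le_sum (f := fun l => (T.2 l).length) (fun l _ => Nat.zero_le _)
    (Finset.mem_univ l)

omit [Fintype ι] in
/-- The number of children of a term is `1 + (number of blocks)`. [folklore] -/
theorem length_fdbChildren (i : ι) (T : FdbTerm ι) : (fdbChildren i T).length = T.1 + 1 := by
  simp [fdbChildren]

omit [Fintype ι] in
/-- **At most `|a|!` terms** in the expansion of `∂_a(A ∘ V)`. [folklore] -/
theorem length_fdbTerms_le_factorial : ∀ a : List ι, (fdbTerms a).length ≤ a.length.factorial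
  | [] => by simp
  | i :: a => by
    have ih := length_fdbTerms_le_factorial a
    rw [fdbTerms_cons, List.length_flatMap, List.length_cons, Nat.factorial_succ]
    calc (List.map (fun T => (fdbChildren i T).length) (fdbTerms a)).sum
        ≤ (List.map (fun _ => a.length + 1) (fdbTerms a)).sum := by
          refine List.sum_le_sum fun T hT => ?_
          rw [length_fdbChildren]
          exact Nat.succ_le_succ (fst_le_length_of_mem_fdbTerms hT)
      _ = (fdbTerms a).length * (a.length + 1) := by
          rw [List.map_const', List.sum_replicate, smul_eq_mul]
      _ ≤ a.length.factorial * (a.length + 1) := Nat.mul_le_mul_right _ ih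
      _ = (a.length + 1) * a.length.factorial := Nat.mul_comm _ _

/-! ## The norm of a term -/

/-- **Norm bound for a Faà di Bruno term**:
`‖(D^kA)(V y)[∂_{b₀}V, …]‖ ≤ ‖D^kA (V y)‖ ∏ₗ ‖∂_{bₗ} V (y)‖`. [folklore] -/
theorem norm_fdbEval_le (A : W' → X) (V : EuclideanSpace ℝ ι → W') (T : FdbTerm ι)
    (y : EuclideanSpace ℝ ι) :
    ‖fdbEval A V T y‖ ≤ ‖iteratedFDeriv ℝ T.1 A (V y)‖ * ∏ l, ‖cwd (T.2 l) V y‖ :=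
  (iteratedFDeriv ℝ T.1 A (V y)).le_opNorm _

end Literature.Analysis.PDE

end
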